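import Literature.Topology.FourManifolds.LinkRegularProjectionParity
import HarnessLib

/-!
# Checkerboard colourings of regular projections of links, II: crossings and the colouring

Topic: Topology / FourManifolds; sequel of `LinkRegularProjectionParity.lean` (strands,
`windSum`, the left winding number `Link.leftWind` with its side, jump and constancy lemmas).
Main results:

* `Link.RegularProjection.exists_isCheckerboard`: **every link Gauss diagram read off a regular
  projection `P : L.RegularProjection` of a link admits a checkerboard colouring**,
  `∃ c, P.diagram.IsCheckerboard c` (Kauffman (1999), §3.2, Lemma 1: planar Gauss codes are
  evenly intersticed; Rasmussen (2010), Lemma 2.4); the colouring is explicit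
  (`Link.RegularProjection.colour`, `isCheckerboard_colour`);
* `Link.HasGaussDiagram.exists_isCheckerboard`, `.isMergeAt_or_isSplitAt` (the merge-or-split
  dichotomy, through `LinkGaussDiagram.dichotomy_of_isCheckerboard` of `LinkKhDichotomy.lean`),
  `.khovanovD_comp_khovanovD` (`d² = 0`, through
  `LinkGaussDiagram.khovanovD_comp_khovanovD_of_isMergeAt_or_isSplitAt` of `LinkKhDSquared.lean`)
  for every realisable link diagram; `even_minimalPeriod_next` (every component of a regular
  projection carries an even number of chord ends).

## Contents and proof

* §5 Local frames at a transversal crossing (namespace `GaussParity`: the constants `crossN`,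
  `crossμ`, `crossκ` of a pair of velocities `V`, `U` with `Im (V Ū) ≠ 0`, `cross_consts`;
  `IsCrossFrame` with its symmetry and the avoidance lemmas `add_notMem`, `quadrant_notMem`,
  `hug_notMem`, `diag_notMem`), and their existence at the crossing of a marked point `p` with
  its partner (`Link.RegularProjection.exists_isCrossFrame`; the dictionary `strand_eq_pt` of
  passages through the crossing point comes from `eq_or_crossing`). Consequence
  (`windSum_hug_eq_deep`): the total winding number about a point hugging the strand of `p` at
  `γ (θ p + σ τ)` on the side `σ' U` equals that about the deep point `y + τ (σ V + σ' U)` of the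
  quadrant (`σ, σ' = ±1`), so the four quadrant values are `ℓ± (p)` and `ℓ± (p) - 1`, where
  `ℓ± (p) = leftWind (θ p ± τ)` (`leftWind_eq_windSum_deep`, `leftWind_sub_one_eq_windSum_deep`,
  with the side sign `crossSign p` making `σ' U` point to the left of `V`). Reading the same four
  points from the partner strand gives `leftWind_crossing`: **(jump)** `ℓ+ (p) ≡ ℓ- (p) + 1` and
  **(partner)** `ℓ+ (partner p) ≡ ℓ+ (p) + 1 (mod 2)` — the two left-hand regions just after a
  crossing are adjacent quadrants.
* §6 Combinatorics of the traversal (`IsTraversalOrder`): enumeration of a component from the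
  successor `b₀` of its wrap point (`exists_base`), the arc `(θ p, arcEnd p)` following a marked
  point (`arcEnd` lifts `θ (next p)` by `2π` at the wrap point) contains no parameter of a marked
  point of the component modulo `2π` (`not_mem_arc`), hence consists of simple points
  (`isSimplePt_of_mem_arc`).
* §7 The colouring `colour p = [leftWind (comp p) (mid p) odd]` at the midpoint of the arc of
  `p`: `colour (next p) = !colour p` (constancy along the arc up to just before `next p`,
  periodicity at the wrap point, the jump at `next p`) and `colour (underPos i) =
  !colour (overPos i)` (the partner relation); the main theorem and its corollaries.

## References

* L. H. Kauffman, *Virtual knot theory*, European J. Combin. 20 (1999), §3.2, Lemma 1.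
  [cite: Kauffman1999, §3.2 Lemma 1]
* J. Rasmussen, *Khovanov homology and the slice genus*, Invent. Math. 182 (2010), §2.3,
  Lemma 2.4. [cite: Rasmussen2010, §2.3]
* D. Bar-Natan, *On Khovanov's categorification of the Jones polynomial*, AGT 2 (2002), §3.2.
  [cite: BarNatan2002, §3.2]
* M. Goussarov, M. Polyak, O. Viro, Topology 39 (2000), §1. [cite: GPV2000, §1]

## Design notes

No `sorry`, no axiom, no named fact. The only `Prop`-valued definition is the frame predicate
`GaussParity.IsCrossFrame`. `[Fintype ι]` is discharged in `exists_isCheckerboard` through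
`Link.RegularProjection.finite_index`.
-/

noncomputable section

open Complex Set Filter Topology Function
open scoped Real

namespace Literature.Topology.FourManifolds

open Literature.Topology.PlaneTopology GaussParity

namespace GaussParity

/-! ## 5. Crossings: local frames and adjacent quadrants -/

/-! ### Local frames at a transversal crossing of two strands -/

/-- The size constant `‖U‖ + ‖V‖ + 1` of a crossing with velocities `V`, `U`. [folklore] -/
def crossN (V U : ℂ) : ℝ := ‖U‖ + ‖V‖ + 1

/-- The **depth ratio** `μ₁ = |Im (V Ū)| / (4 N²)` of a crossing: points `y + x₁ V + x₂ U` with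
`μ₁ τ ≤ |xᵢ| ≤ τ` are "deep inside a quadrant". [folklore] -/
def crossμ (V U : ℂ) : ℝ := |(V * starRingEnd ℂ U).im| / (4 * crossN V U ^ 2)

/-- The **slope** `κ = μ₁ |Im (V Ū)| / (4 N)` of the cones used at a crossing. [folklore] -/
def crossκ (V U : ℂ) : ℝ := crossμ V U * |(V * starRingEnd ℂ U).im| / (4 * crossN V U)

/-- `crossN` is symmetric. [folklore] -/
theorem crossN_comm (V U : ℂ) : crossN V U = crossN U V := by unfold crossN; ring

/-- `crossμ` is symmetric. [folklore] -/
theorem crossμ_comm (V U : ℂ) : crossμ V U = crossμ U V := by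
  unfold crossμ; rw [abs_im_mul_conj_comm, crossN_comm]

/-- `crossκ` is symmetric. [folklore] -/
theorem crossκ_comm (V U : ℂ) : crossκ V U = crossκ U V := by
  unfold crossκ; rw [crossμ_comm, abs_im_mul_conj_comm, crossN_comm]

/-- `|Im (V Ū)| ≤ ‖V‖ ‖U‖`. [folklore] -/
theorem abs_im_mul_conj_le (V U : ℂ) : |(V * starRingEnd ℂ U).im| ≤ ‖V‖ * ‖U‖ :=
  (Complex.abs_im_le_norm _).trans (by rw [norm_mul, Complex.norm_conj])

/-- **The inequalities between the crossing constants** used below: with `D = |Im (V Ū)| > 0`,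
`N = ‖U‖ + ‖V‖ + 1`, `μ₁ = crossμ`, `κ = crossκ`: positivity, `μ₁ ≤ 1`, `κ ≤ N`, and the
smallness of `κ` against `D`, `μ₁ D`, `‖U‖`, `‖V‖`. [folklore] -/
theorem cross_consts {V U : ℂ} (hD : (V * starRingEnd ℂ U).im ≠ 0) :
    0 < crossN V U ∧ ‖U‖ < crossN V U ∧ ‖V‖ < crossN V U ∧
    0 < crossμ V U ∧ crossμ V U ≤ 1 ∧ 0 < crossκ V U ∧ crossκ V U ≤ crossN V U ∧
    4 * crossκ V U * ‖U‖ ≤ |(V * starRingEnd ℂ U).im| ∧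
    4 * crossκ V U * ‖V‖ ≤ |(V * starRingEnd ℂ U).im| ∧
    3 * crossκ V U * ‖U‖ < crossμ V U * |(V * starRingEnd ℂ U).im| ∧
    3 * crossκ V U * ‖V‖ < crossμ V U * |(V * starRingEnd ℂ U).im| ∧
    2 * crossκ V U * (‖U‖ + ‖V‖) ≤ |(V * starRingEnd ℂ U).im| ∧
    crossκ V U * ‖U‖ < |(V * starRingEnd ℂ U).im| ∧
    2 * crossμ V U * crossN V U ^ 2 < |(V * starRingEnd ℂ U).im| := by
  set D := |(V * starRingEnd ℂ U).im| with hDdef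
  set N := crossN V U with hN
  have hD0 : 0 < D := abs_pos.2 hD
  have hU := norm_nonneg U
  have hV := norm_nonneg V
  have hN1 : N = ‖U‖ + ‖V‖ + 1 := rfl
  have hN0 : 0 < N := by rw [hN1]; positivity
  have hUN : ‖U‖ < N := by rw [hN1]; linarith
  have hVN : ‖V‖ < N := by rw [hN1]; linarith
  have hDN : D ≤ N ^ 2 := by
    have := abs_im_mul_conj_le V U
    rw [← hDdef] at this
    nlinarith
  have hμ : crossμ V U = D / (4 * N ^ 2) := rfl
  have hκ : crossκ V U = crossμ V U * D / (4 * N) := rfl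
  have hμ0 : 0 < crossμ V U := by rw [hμ]; positivity
  have hμ1 : crossμ V U ≤ 1 := by
    rw [hμ, div_le_one (by positivity)]; nlinarith
  have hκ0 : 0 < crossκ V U := by rw [hκ]; positivity
  -- `κ N = μ₁ D / 4`
  have hκN : crossκ V U * N = crossμ V U * D / 4 := by
    rw [hκ]; field_simp
  have hμN : crossμ V U * N ^ 2 = D / 4 := by
    rw [hμ]; field_simp
  have hκU : crossκ V U * ‖U‖ ≤ crossκ V U * N := mul_le_mul_of_nonneg_left hUN.le hκ0.le
  have hκV : crossκ V U * ‖V‖ ≤ crossκ V U * N := mul_le_mul_of_nonneg_left hVN.le hκ0.le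
  have hκU' : crossκ V U * ‖U‖ < crossκ V U * N := mul_lt_mul_of_pos_left hUN hκ0
  have hκV' : crossκ V U * ‖V‖ < crossκ V U * N := mul_lt_mul_of_pos_left hVN hκ0
  have hμD : crossμ V U * D ≤ D := by nlinarith
  refine ⟨hN0, hUN, hVN, hμ0, hμ1, hκ0, ?_, ?_, ?_, ?_, ?_, ?_, ?_, ?_⟩
  · nlinarith
  · nlinarith
  · nlinarith
  · nlinarith
  · nlinarith
  · nlinarith
  · nlinarith
  · nlinarith

/-- A **local frame at a transversal crossing** `y` of the strands `α` (velocity `V`) and `β`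
(velocity `U`), of window `δ` and radius `η`, for a set `T` (the trace): both strands
satisfy the uniform cone estimate of slope `crossκ V U` on the window, pass through `y` at the
parameter `0`, and `T` meets the ball of radius `η` about `y` only along the two windows.
[folklore] -/
structure IsCrossFrame (T : Set ℂ) (α β : ℝ → ℂ) (y V U : ℂ) (δ η : ℝ) : Prop where
  /-- The window is non-degenerate. -/
  δ_pos : 0 < δ
  /-- The radius is positive. -/
  η_pos : 0 < η
  /-- The first strand passes through `y` at parameter `0`. -/
  α_zero : α 0 = y
  /-- The second strand passes through `y` at parameter `0`. -/
  β_zero : β 0 = y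
  /-- Uniform cone for the first strand. -/
  cone_α : ∀ s s', |s| ≤ δ → |s'| ≤ δ →
    ‖α s - α s' - ((s - s' : ℝ) : ℂ) * V‖ ≤ crossκ V U * |s - s'|
  /-- Uniform cone for the second strand. -/
  cone_β : ∀ s s', |s| ≤ δ → |s'| ≤ δ →
    ‖β s - β s' - ((s - s' : ℝ) : ℂ) * U‖ ≤ crossκ V U * |s - s'|
  /-- Near `y` the set `T` lies on the two windows. -/
  far : ∀ z ∈ T, ‖z - y‖ < η → ∃ s, |s| < δ ∧ (z = α s ∨ z = β s)

namespace IsCrossFrame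

variable {T : Set ℂ} {α β : ℝ → ℂ} {y V U : ℂ} {δ η : ℝ}

/-- The roles of the two strands can be exchanged. [folklore] -/
theorem symm (hF : IsCrossFrame T α β y V U δ η) : IsCrossFrame T β α y U V δ η where
  δ_pos := hF.δ_pos
  η_pos := hF.η_pos
  α_zero := hF.β_zero
  β_zero := hF.α_zero
  cone_α := by rw [crossκ_comm]; exact hF.cone_β
  cone_β := by rw [crossκ_comm]; exact hF.cone_α
  far z hz hzy := by
    obtain ⟨s, hs, h⟩ := hF.far z hz hzy
    exact ⟨s, hs, h.symm⟩

/-- The one-point cone for the first strand. [folklore] -/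
theorem cone_α₀ (hF : IsCrossFrame T α β y V U δ η) {s : ℝ} (hs : |s| ≤ δ) :
    ‖α s - y - (s : ℂ) * V‖ ≤ crossκ V U * |s| := by
  have := hF.cone_α s 0 hs (by rw [abs_zero]; exact hF.δ_pos.le)
  simp only [hF.α_zero, sub_zero] at this
  exact this

/-- The one-point cone for the second strand. [folklore] -/
theorem cone_β₀ (hF : IsCrossFrame T α β y V U δ η) {s : ℝ} (hs : |s| ≤ δ) :
    ‖β s - y - (s : ℂ) * U‖ ≤ crossκ V U * |s| := by
  have := hF.cone_β s 0 hs (by rw [abs_zero]; exact hF.δ_pos.le)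
  simp only [hF.β_zero, sub_zero] at this
  exact this

/-- **Points hugging the first strand are off `T`**: `α s' + v ∉ T` when `v` points across `V`,
`‖v‖` is small compared to `|s'|` (so that the second strand is missed too) and the point is in
the ball. [folklore] -/
theorem add_notMem (hF : IsCrossFrame T α β y V U δ η) (hD : (V * starRingEnd ℂ U).im ≠ 0)
    {s' : ℝ} (hs' : |s'| ≤ δ) {v : ℂ} (hv : crossκ V U * ‖v‖ < |(v * starRingEnd ℂ V).im|)
    (hvs : 2 * ‖v‖ * (‖U‖ + ‖V‖) < |s'| * |(V * starRingEnd ℂ U).im|)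
    (hη : ‖α s' - y‖ + ‖v‖ < η) : α s' + v ∉ T := by
  obtain ⟨-, -, -, -, -, hκ0, -, -, -, -, -, h2κ, -⟩ := cross_consts hD
  intro hmem
  have hclose : ‖α s' + v - y‖ < η := by
    rw [show α s' + v - y = (α s' - y) + v by ring]; exact (norm_add_le _ _).trans_lt hη
  obtain ⟨s, hs, h | h⟩ := hF.far _ hmem hclose
  · exact ne_add_of_window_cone hκ0.le hF.cone_α hv hs.le hs' h.symm
  · exact ne_add_of_cones hκ0.le (fun s hs => hF.cone_β₀ hs) hs.le (hF.cone_α₀ hs') h2κ hvs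
      h.symm

/-- **Points deep inside a quadrant are off `T`**: `y + x₁ V + x₂ U + e ∉ T` when
`μ₁ τ ≤ |x₁|, |x₂| ≤ τ`, `‖e‖ ≤ κ τ` and the point is in the ball. [folklore] -/
theorem quadrant_notMem (hF : IsCrossFrame T α β y V U δ η) (hD : (V * starRingEnd ℂ U).im ≠ 0)
    {τ x₁ x₂ : ℝ} {e : ℂ} (hτ : 0 < τ) (hx₁ : |x₁| ≤ τ) (hx₁' : crossμ V U * τ ≤ |x₁|)
    (hx₂ : |x₂| ≤ τ) (hx₂' : crossμ V U * τ ≤ |x₂|) (he : ‖e‖ ≤ crossκ V U * τ)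
    (hη : ‖(x₁ : ℂ) * V + (x₂ : ℂ) * U + e‖ < η) :
    y + (x₁ : ℂ) * V + (x₂ : ℂ) * U + e ∉ T := by
  obtain ⟨-, -, -, -, -, hκ0, -, h4U, h4V, h3U, h3V, -, -⟩ := cross_consts hD
  intro hmem
  have hclose : ‖y + (x₁ : ℂ) * V + (x₂ : ℂ) * U + e - y‖ < η := by
    rw [show y + (x₁ : ℂ) * V + (x₂ : ℂ) * U + e - y = (x₁ : ℂ) * V + (x₂ : ℂ) * U + e by ring]
    exact hη
  obtain ⟨s, hs, h | h⟩ := hF.far _ hmem hclose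
  · exact ne_quadrant_of_cone hκ0.le (fun s hs => hF.cone_α₀ hs) hs.le h4U h3V hτ hx₁ hx₂' he
      h.symm
  · rw [abs_im_mul_conj_comm] at h4V h3U
    refine ne_quadrant_of_cone hκ0.le (fun s hs => hF.cone_β₀ hs) hs.le h4V h3U hτ hx₂ hx₁' he
      ?_
    rw [← h]; ring

/-- **The segment hugging the first strand** at `α (σ τ)` in the direction `σ' U`
(`σ, σ' = ±1`), from height `ε > 0` up to height `μ₁ τ`, misses `T` (for `τ` small).
[folklore] -/
theorem hug_notMem (hF : IsCrossFrame T α β y V U δ η) (hD : (V * starRingEnd ℂ U).im ≠ 0)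
    {σ σ' τ μ : ℝ} (hσ : σ = 1 ∨ σ = -1) (hσ' : σ' = 1 ∨ σ' = -1) (hτ : 0 < τ) (hτδ : τ ≤ δ)
    (hτη : 2 * τ * crossN V U ≤ η) (hμ0 : 0 < μ) (hμ : μ ≤ crossμ V U * τ) :
    α (σ * τ) + ((μ * σ' : ℝ) : ℂ) * U ∉ T := by
  obtain ⟨hN0, hUN, hVN, hμ₀, hμ1, hκ0, hκN, -, -, -, -, -, hκU, h2μ⟩ := cross_consts hD
  have hστ : |σ * τ| = τ := by
    rcases hσ with rfl | rfl <;> simp [abs_of_pos hτ]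
  have hσ'1 : |σ'| = 1 := by rcases hσ' with rfl | rfl <;> simp
  have hvn : ‖((μ * σ' : ℝ) : ℂ) * U‖ = μ * ‖U‖ := by
    rw [norm_mul, Complex.norm_real, Real.norm_eq_abs, abs_mul, hσ'1, abs_of_pos hμ0, mul_one]
  refine hF.add_notMem hD (by rw [hστ]; exact hτδ) ?_ ?_ ?_
  · rw [hvn, mul_assoc ((μ * σ' : ℝ) : ℂ), Complex.im_ofReal_mul, abs_mul, abs_mul, hσ'1,
      abs_of_pos hμ0, mul_one, ← abs_im_mul_conj_comm V U]
    nlinarith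
  · rw [hvn, hστ]
    have hU := norm_nonneg U
    have hV := norm_nonneg V
    have : μ * ‖U‖ * (‖U‖ + ‖V‖) ≤ crossμ V U * τ * crossN V U ^ 2 := by
      have h0 : ‖U‖ + ‖V‖ ≤ crossN V U := by unfold crossN; linarith
      have h1 : ‖U‖ * (‖U‖ + ‖V‖) ≤ crossN V U ^ 2 := by
        nlinarith [mul_le_mul hUN.le h0 (by positivity) hN0.le]
      calc μ * ‖U‖ * (‖U‖ + ‖V‖) = μ * (‖U‖ * (‖U‖ + ‖V‖)) := by ring
        _ ≤ crossμ V U * τ * crossN V U ^ 2 :=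
          mul_le_mul hμ h1 (by positivity) (by positivity)
    nlinarith [mul_lt_mul_of_pos_left h2μ hτ]
  · rw [hvn]
    have h1 := hF.cone_α₀ (s := σ * τ) (by rw [hστ]; exact hτδ)
    rw [hστ] at h1
    have h2 : ‖α (σ * τ) - y‖ ≤ (crossκ V U + ‖V‖) * τ := by
      have := norm_add_le (α (σ * τ) - y - ((σ * τ : ℝ) : ℂ) * V) (((σ * τ : ℝ) : ℂ) * V)
      rw [sub_add_cancel, norm_mul, Complex.norm_real, Real.norm_eq_abs, hστ] at this
      nlinarith
    have h3 : μ * ‖U‖ ≤ crossμ V U * τ * ‖U‖ := by nlinarith [norm_nonneg U]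
    have h4 : crossμ V U * τ * ‖U‖ ≤ τ * ‖U‖ := by
      have := mul_le_mul_of_nonneg_right hμ1 (mul_nonneg hτ.le (norm_nonneg U))
      linarith
    have h5 : (crossκ V U + ‖V‖) * τ + τ * ‖U‖ < 2 * τ * crossN V U := by
      have : crossκ V U + ‖V‖ + ‖U‖ < 2 * crossN V U := by
        unfold crossN at hκN ⊢; linarith
      nlinarith
    linarith

/-- **The segment from the hugging point into the quadrant**: every point of the segment from
`α (σ τ) + μ₁ τ σ' U` to the deep point `y + τ (σ V + σ' U)` misses `T`. [folklore] -/
theorem diag_notMem (hF : IsCrossFrame T α β y V U δ η) (hD : (V * starRingEnd ℂ U).im ≠ 0)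
    {σ σ' τ : ℝ} (hσ : σ = 1 ∨ σ = -1) (hσ' : σ' = 1 ∨ σ' = -1) (hτ : 0 < τ) (hτδ : τ ≤ δ)
    (hτη : 2 * τ * crossN V U ≤ η) {lam : ℝ} (hl : lam ∈ Icc (0 : ℝ) 1) :
    ((1 - lam : ℝ) : ℂ) * (α (σ * τ) + ((crossμ V U * τ * σ' : ℝ) : ℂ) * U) +
      (lam : ℂ) * (y + (τ : ℂ) * ((σ : ℂ) * V + (σ' : ℂ) * U)) ∉ T := by
  obtain ⟨hN0, hUN, hVN, hμ₀, hμ1, hκ0, hκN, -⟩ := cross_consts hD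
  obtain ⟨hl0, hl1⟩ := hl
  have hστ : |σ * τ| = τ := by
    rcases hσ with rfl | rfl <;> simp [abs_of_pos hτ]
  have hσ'1 : |σ'| = 1 := by rcases hσ' with rfl | rfl <;> simp
  set eA := α (σ * τ) - y - ((σ * τ : ℝ) : ℂ) * V with heA
  have heAn : ‖eA‖ ≤ crossκ V U * τ := by
    have := hF.cone_α₀ (s := σ * τ) (by rw [hστ]; exact hτδ); rwa [hστ] at this
  set x₂ : ℝ := ((1 - lam) * crossμ V U + lam) * τ * σ' with hx₂
  set e : ℂ := ((1 - lam : ℝ) : ℂ) * eA with he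
  have hpt : ((1 - lam : ℝ) : ℂ) * (α (σ * τ) + ((crossμ V U * τ * σ' : ℝ) : ℂ) * U) +
      (lam : ℂ) * (y + (τ : ℂ) * ((σ : ℂ) * V + (σ' : ℂ) * U)) =
      y + ((σ * τ : ℝ) : ℂ) * V + (x₂ : ℂ) * U + e := by
    have : α (σ * τ) = y + ((σ * τ : ℝ) : ℂ) * V + eA := by rw [heA]; ring
    rw [this, hx₂, he]; push_cast; ring
  rw [hpt]
  have hx₂abs : |x₂| = ((1 - lam) * crossμ V U + lam) * τ := by
    rw [hx₂, abs_mul, hσ'1, mul_one, abs_of_nonneg]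
    have : 0 ≤ (1 - lam) * crossμ V U + lam := by nlinarith
    positivity
  have hc1 : (1 - lam) * crossμ V U + lam ≤ 1 := by
    nlinarith [mul_le_mul_of_nonneg_left hμ1 (sub_nonneg.2 hl1)]
  have hc2 : crossμ V U ≤ (1 - lam) * crossμ V U + lam := by
    nlinarith [mul_nonneg hl0 (sub_nonneg.2 hμ1)]
  have hx₂τ : |x₂| ≤ τ := by
    rw [hx₂abs]; nlinarith [mul_le_mul_of_nonneg_right hc1 hτ.le]
  have hx₂μ : crossμ V U * τ ≤ |x₂| := by
    rw [hx₂abs]; nlinarith [mul_le_mul_of_nonneg_right hc2 hτ.le]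
  have hen : ‖e‖ ≤ crossκ V U * τ := by
    rw [he, norm_mul, Complex.norm_real, Real.norm_eq_abs, abs_of_nonneg (by linarith)]
    nlinarith [mul_le_mul_of_nonneg_left heAn (sub_nonneg.2 hl1),
      mul_nonneg hl0 (mul_nonneg hκ0.le hτ.le)]
  refine hF.quadrant_notMem hD hτ (by rw [hστ]) (by rw [hστ]; nlinarith) hx₂τ hx₂μ hen ?_
  calc ‖((σ * τ : ℝ) : ℂ) * V + (x₂ : ℂ) * U + e‖
      ≤ ‖((σ * τ : ℝ) : ℂ) * V‖ + ‖(x₂ : ℂ) * U‖ + ‖e‖ := norm_add₃_le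
    _ = τ * ‖V‖ + |x₂| * ‖U‖ + ‖e‖ := by
        rw [norm_mul, norm_mul, Complex.norm_real, Complex.norm_real, Real.norm_eq_abs,
          Real.norm_eq_abs, hστ]
    _ ≤ τ * ‖V‖ + τ * ‖U‖ + crossκ V U * τ := by
        nlinarith [mul_le_mul_of_nonneg_right hx₂τ (norm_nonneg U)]
    _ < η := by
        have : ‖V‖ + ‖U‖ + crossκ V U < 2 * crossN V U := by unfold crossN at hκN ⊢; linarith
        nlinarith

end IsCrossFrame

end GaussParity

namespace Link.RegularProjection

variable {ι : Type*} {L : Link ι}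

/-! ### The two strands through a crossing -/

/-- The crossing point of the marked point `p`, read in `ℂ`. [folklore] -/
def pt (P : L.RegularProjection) (p : Fin (2 * P.diagram.n)) : ℂ := L.strand (P.comp p) (P.θ p)

/-- The velocity of the strand through the marked point `p`. [folklore] -/
def vel (P : L.RegularProjection) (p : Fin (2 * P.diagram.n)) : ℂ :=
  L.strandDeriv (P.comp p) (P.θ p)

/-- The **side sign** of the marked point `p`: `+1` if the partner strand's velocity points to
the left of the strand of `p`, `-1` if it points to the right. [folklore] -/
def crossSign (P : L.RegularProjection) (p : Fin (2 * P.diagram.n)) : ℝ :=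
  if (P.vel p * starRingEnd ℂ (P.vel (P.diagram.partner p))).im < 0 then 1 else -1

/-- The partner passage is through the same point. [folklore] -/
theorem pt_partner (P : L.RegularProjection) (p : Fin (2 * P.diagram.n)) :
    P.pt (P.diagram.partner p) = P.pt p := by
  unfold pt
  rw [strand_eq_iff]
  obtain ⟨i, rfl | rfl⟩ := P.diagram.exists_chord p
  · rw [LinkGaussDiagram.partner_overPos]; exact (P.double i).symm
  · rw [LinkGaussDiagram.partner_underPos]; exact P.double i

/-- **Transversality**: `Im (V Ū) ≠ 0` for the velocities `V`, `U` of the two strands through a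
crossing. [folklore] -/
theorem im_vel_mul_conj_ne_zero (P : L.RegularProjection) (p : Fin (2 * P.diagram.n)) :
    (P.vel p * starRingEnd ℂ (P.vel (P.diagram.partner p))).im ≠ 0 := by
  have key : ∀ i, (P.vel (P.diagram.overPos i) *
      starRingEnd ℂ (P.vel (P.diagram.underPos i))).im ≠ 0 := by
    intro i
    have hd := P.det_ne_zero i
    rw [Matrix.det_fin_two_of] at hd
    unfold vel Link.strandDeriv Knot.cplaneDeriv
    rw [Knot.im_mul_conj_equivRealProdCLM_symm]
    intro h; apply hd; linarith
  obtain ⟨i, rfl | rfl⟩ := P.diagram.exists_chord p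
  · rw [LinkGaussDiagram.partner_overPos]; exact key i
  · rw [LinkGaussDiagram.partner_underPos]
    intro h
    apply key i
    have := abs_im_mul_conj_comm (P.vel (P.diagram.overPos i)) (P.vel (P.diagram.underPos i))
    rw [h, abs_zero] at this
    exact abs_eq_zero.1 this

/-- The side sign is `±1`. [folklore] -/
theorem crossSign_eq_or (P : L.RegularProjection) (p : Fin (2 * P.diagram.n)) :
    P.crossSign p = 1 ∨ P.crossSign p = -1 := by
  unfold crossSign; split_ifs <;> simp

/-- The side signs of the two passages of a crossing are opposite. [folklore] -/
theorem crossSign_cases (P : L.RegularProjection) (p : Fin (2 * P.diagram.n)) :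
    (P.crossSign p = 1 ∧ P.crossSign (P.diagram.partner p) = -1) ∨
      (P.crossSign p = -1 ∧ P.crossSign (P.diagram.partner p) = 1) := by
  have hD := P.im_vel_mul_conj_ne_zero p
  have hneg : (P.vel (P.diagram.partner p) * starRingEnd ℂ (P.vel p)).im =
      -(P.vel p * starRingEnd ℂ (P.vel (P.diagram.partner p))).im := by
    rw [← Complex.conj_conj (P.vel (P.diagram.partner p) * _), map_mul, Complex.conj_conj,
      mul_comm, Complex.conj_im]
  unfold crossSign
  rw [LinkGaussDiagram.partner_partner, hneg]
  by_cases h : (P.vel p * starRingEnd ℂ (P.vel (P.diagram.partner p))).im < 0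
  · left; rw [if_pos h, if_neg (by linarith)]; exact ⟨rfl, rfl⟩
  · right; rw [if_neg h, if_pos (by rw [neg_lt_zero]; exact lt_of_le_of_ne (not_lt.1 h) hD.symm)]
    exact ⟨rfl, rfl⟩

/-- **The side sign makes `σ' U` point to the left of `V`**: `Im ((σ' U) V̄) > 0`. [folklore] -/
theorem crossSign_mul_im_pos (P : L.RegularProjection) (p : Fin (2 * P.diagram.n)) :
    0 < P.crossSign p * (P.vel (P.diagram.partner p) * starRingEnd ℂ (P.vel p)).im := by
  have hD := P.im_vel_mul_conj_ne_zero p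
  have hneg : (P.vel (P.diagram.partner p) * starRingEnd ℂ (P.vel p)).im =
      -(P.vel p * starRingEnd ℂ (P.vel (P.diagram.partner p))).im := by
    rw [← Complex.conj_conj (P.vel (P.diagram.partner p) * _), map_mul, Complex.conj_conj,
      mul_comm, Complex.conj_im]
  unfold crossSign
  rw [hneg]
  split_ifs with h
  · linarith
  · have := lt_of_le_of_ne (not_lt.1 h) hD.symm; linarith

/-- **The double-point dictionary**: a strand passes through the crossing point of `p` only as
the strand of `p` at parameters congruent to `θ p`, or as the strand of the partner of `p` at
parameters congruent to its parameter (`eq_or_crossing` and bookkeeping). [folklore] -/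
theorem strand_eq_pt (P : L.RegularProjection) (p : Fin (2 * P.diagram.n)) {c : ι} {s : ℝ}
    (h : L.strand c s = P.pt p) :
    (c = P.comp p ∧ ∃ k : ℤ, s = P.θ p + k * (2 * π)) ∨
      (c = P.comp (P.diagram.partner p) ∧
        ∃ k : ℤ, s = P.θ (P.diagram.partner p) + k * (2 * π)) := by
  unfold pt at h
  rw [strand_eq_iff] at h
  rcases P.eq_or_crossing c (P.comp p) s (P.θ p) h with ⟨hc, k, hk⟩ | ⟨j, k, l, hset⟩
  · exact Or.inl ⟨hc, -k, by rw [hk]; push_cast; ring⟩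
  · -- read a membership `(c, s + 2πk) = (comp r, θ r)`
    have read : ∀ r, (c, s + k * (2 * π)) = (P.comp r, P.θ r) →
        c = P.comp r ∧ ∃ k' : ℤ, s = P.θ r + k' * (2 * π) := fun r hr => by
      have h2 : s + k * (2 * π) = P.θ r := congrArg Prod.snd hr
      exact ⟨congrArg Prod.fst hr, -k, by rw [← h2]; push_cast; ring⟩
    have key : ∀ r, (P.comp p, P.θ p + l * (2 * π)) = (P.comp r, P.θ r) → p = r :=
      fun r hr => by
      have h1 : P.comp p = P.comp r := congrArg Prod.fst hr
      have h2 : P.θ p + l * (2 * π) = P.θ r := congrArg Prod.snd hr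
      exact P.traversal.eq_of_θ_eq_add_int_mul h1 h2.symm
    have hp : (P.comp p, P.θ p + l * (2 * π)) ∈ ({(P.comp (P.diagram.overPos j),
        P.θ (P.diagram.overPos j)), (P.comp (P.diagram.underPos j), P.θ (P.diagram.underPos j))} :
        Set (ι × ℝ)) := hset ▸ mem_insert_of_mem _ rfl
    have hc : (c, s + k * (2 * π)) ∈ ({(P.comp (P.diagram.overPos j),
        P.θ (P.diagram.overPos j)), (P.comp (P.diagram.underPos j), P.θ (P.diagram.underPos j))} :
        Set (ι × ℝ)) := hset ▸ mem_insert _ _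
    simp only [mem_insert_iff, mem_singleton_iff] at hp hc
    rcases hp with hp | hp
    · have hpo := key _ hp
      rcases hc with hc | hc
      · exact Or.inl (hpo ▸ read _ hc)
      · right; rw [hpo, LinkGaussDiagram.partner_overPos]; exact read _ hc
    · have hpu := key _ hp
      rcases hc with hc | hc
      · right; rw [hpu, LinkGaussDiagram.partner_underPos]; exact read _ hc
      · exact Or.inl (hpu ▸ read _ hc)

/-- **Local frames exist at crossings** (window cones for both strands with the slope
`crossκ V U`, far-ness by `exists_far`), together with the continuity of the velocity of the
strand of `p` and the parametric form of far-ness. [folklore] -/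
theorem exists_isCrossFrame (P : L.RegularProjection) [Fintype ι] (p : Fin (2 * P.diagram.n)) :
    ∃ δ η, δ ≤ 1 ∧ IsCrossFrame L.trace (fun s => L.strand (P.comp p) (P.θ p + s))
      (fun s => L.strand (P.comp (P.diagram.partner p)) (P.θ (P.diagram.partner p) + s))
      (P.pt p) (P.vel p) (P.vel (P.diagram.partner p)) δ η ∧
      (∀ s, |s| ≤ δ → ‖L.strandDeriv (P.comp p) (P.θ p + s) - P.vel p‖ ≤
        crossκ (P.vel p) (P.vel (P.diagram.partner p))) ∧
      (∀ c u, ‖L.strand c u - P.pt p‖ < η →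
        (c = P.comp p ∧ ∃ k : ℤ, |u - P.θ p - k * (2 * π)| < δ) ∨
        (c = P.comp (P.diagram.partner p) ∧
          ∃ k : ℤ, |u - P.θ (P.diagram.partner p) - k * (2 * π)| < δ)) := by
  classical
  set q := P.diagram.partner p with hq
  set a := P.comp p with ha
  set b := P.comp q with hb
  set V := P.vel p with hV
  set U := P.vel q with hU
  have hD := P.im_vel_mul_conj_ne_zero p
  obtain ⟨-, -, -, -, -, hκ0, -⟩ := cross_consts hD
  obtain ⟨δa, hδa, hconea, hvela⟩ := exists_window_cone (P.hasDerivAt_strand a)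
    ((P.continuous_strandDeriv a).continuousAt (x := P.θ p)) hκ0
  obtain ⟨δb, hδb, hconeb, -⟩ := exists_window_cone (P.hasDerivAt_strand b)
    ((P.continuous_strandDeriv b).continuousAt (x := P.θ q)) hκ0
  set δ := min (min δa δb) 1 with hδ
  have hδ0 : 0 < δ := lt_min (lt_min hδa hδb) one_pos
  have hδa' : δ ≤ δa := (min_le_left _ _).trans (min_le_left _ _)
  have hδb' : δ ≤ δb := (min_le_left _ _).trans (min_le_right _ _)
  have hZ : ∀ c s, L.strand c s = P.pt p →
      ∃ z ∈ ({(a, P.θ p), (b, P.θ q)} : Finset (ι × ℝ)), z.1 = c ∧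
        ∃ k : ℤ, s = z.2 + k * (2 * π) := by
    intro c s hs
    rcases P.strand_eq_pt p hs with ⟨rfl, k, hk⟩ | ⟨rfl, k, hk⟩
    · exact ⟨(P.comp p, P.θ p), Finset.mem_insert_self _ _, rfl, k, hk⟩
    · exact ⟨(P.comp q, P.θ q), Finset.mem_insert_of_mem (Finset.mem_singleton_self _), rfl,
        k, hk⟩
  obtain ⟨η, hη, hfar⟩ := P.exists_far hZ hδ0
  have hfarP : ∀ c u, ‖L.strand c u - P.pt p‖ < η →
      (c = a ∧ ∃ k : ℤ, |u - P.θ p - k * (2 * π)| < δ) ∨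
      (c = b ∧ ∃ k : ℤ, |u - P.θ q - k * (2 * π)| < δ) := by
    intro c u hu
    obtain ⟨z, hz, hzc, k, hk⟩ := hfar c u hu
    simp only [Finset.mem_insert, Finset.mem_singleton] at hz
    rcases hz with rfl | rfl
    · exact Or.inl ⟨hzc.symm, k, hk⟩
    · exact Or.inr ⟨hzc.symm, k, hk⟩
  refine ⟨δ, η, min_le_right _ _, ⟨hδ0, hη, ?_, ?_, fun s s' hs hs' => ?_,
    fun s s' hs hs' => ?_, fun z hz hzy => ?_⟩, fun s hs => ?_, hfarP⟩
  · show L.strand (P.comp p) (P.θ p + 0) = L.strand (P.comp p) (P.θ p)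
    rw [add_zero]
  · show L.strand b (P.θ q + 0) = P.pt p
    rw [add_zero, ← P.pt_partner p]; rfl
  · have := hconea (P.θ p + s) (P.θ p + s') (by simpa using hs.trans hδa')
      (by simpa using hs'.trans hδa')
    rwa [add_sub_add_left_eq_sub] at this
  · have := hconeb (P.θ q + s) (P.θ q + s') (by simpa using hs.trans hδb')
      (by simpa using hs'.trans hδb')
    rwa [add_sub_add_left_eq_sub] at this
  · obtain ⟨c, u, rfl⟩ := L.mem_trace.1 hz
    rcases hfarP c u hzy with ⟨rfl, k, hk⟩ | ⟨rfl, k, hk⟩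
    · refine ⟨u - P.θ p - k * (2 * π), hk, Or.inl ?_⟩
      show L.strand (P.comp p) u = L.strand (P.comp p) (P.θ p + (u - P.θ p - k * (2 * π)))
      rw [show P.θ p + (u - P.θ p - k * (2 * π)) = u + ((-k : ℤ) : ℝ) * (2 * π) by
        push_cast; ring, L.strand_add_int_mul]
    · refine ⟨u - P.θ q - k * (2 * π), hk, Or.inr ?_⟩
      show L.strand (P.comp q) u = L.strand (P.comp q) (P.θ q + (u - P.θ q - k * (2 * π)))
      rw [show P.θ q + (u - P.θ q - k * (2 * π)) = u + ((-k : ℤ) : ℝ) * (2 * π) by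
        push_cast; ring, L.strand_add_int_mul]
  · exact hvela (P.θ p + s) (by simpa using hs.trans hδa')

/-- **Parameters next to a crossing are simple points.** [folklore] -/
theorem isSimplePt_near_crossing (P : L.RegularProjection) [Fintype ι]
    (p : Fin (2 * P.diagram.n)) :
    ∀ᶠ τ in 𝓝 (0 : ℝ), τ ≠ 0 → L.IsSimplePt (P.comp p) (P.θ p + τ) := by
  obtain ⟨δ, η, -, hF, -, hfarP⟩ := P.exists_isCrossFrame p
  have hD := P.im_vel_mul_conj_ne_zero p
  obtain ⟨hN0, hUN, hVN, -, -, hκ0, hκN, h4U, h4V, -, -, h2κ, -⟩ := cross_consts hD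
  set V := P.vel p with hV
  set U := P.vel (P.diagram.partner p) with hU
  set κ := crossκ V U with hκ
  set N := crossN V U with hN
  have hU0 : U ≠ 0 := by rintro h0; rw [h0, map_zero, mul_zero] at hD; exact hD rfl
  have hκV : κ < ‖V‖ := by
    have hUn : 0 < ‖U‖ := norm_pos_iff.2 hU0
    have := abs_im_mul_conj_le V U
    by_contra hle
    push Not at hle
    nlinarith [mul_le_mul_of_nonneg_right hle hUn.le]
  set τ₁ := min δ (η / (2 * N)) with hτ₁
  have hτ₁0 : 0 < τ₁ := lt_min hF.δ_pos (div_pos hF.η_pos (by positivity))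
  filter_upwards [Metric.ball_mem_nhds (0 : ℝ) hτ₁0] with τ hτ hτ0
  rw [Metric.mem_ball, dist_zero_right, Real.norm_eq_abs] at hτ
  have hτδ : |τ| ≤ δ := (hτ.trans_le (min_le_left _ _)).le
  have hcl : ‖L.strand (P.comp p) (P.θ p + τ) - P.pt p‖ < η := by
    have h1 := hF.cone_α₀ hτδ
    have h2 : ‖L.strand (P.comp p) (P.θ p + τ) - P.pt p‖ ≤ (κ + ‖V‖) * |τ| := by
      have := norm_add_le (L.strand (P.comp p) (P.θ p + τ) - P.pt p - (τ : ℂ) * V) ((τ : ℂ) * V)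
      rw [sub_add_cancel, norm_mul, Complex.norm_real, Real.norm_eq_abs] at this
      nlinarith
    have h3 : |τ| < η / (2 * N) := hτ.trans_le (min_le_right _ _)
    rw [lt_div_iff₀ (by positivity)] at h3
    have : κ + ‖V‖ ≤ 2 * N := by linarith
    nlinarith [abs_nonneg τ]
  intro c u hu
  have hu' : ‖L.strand c u - P.pt p‖ < η := by rwa [hu]
  rcases hfarP c u hu' with ⟨rfl, k, hk⟩ | ⟨rfl, k, hk⟩
  · refine ⟨rfl, k, ?_⟩
    set s := u - P.θ p - k * (2 * π) with hs
    have hus : L.strand (P.comp p) u = L.strand (P.comp p) (P.θ p + s) := by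
      rw [show P.θ p + s = u + ((-k : ℤ) : ℝ) * (2 * π) by rw [hs]; push_cast; ring,
        L.strand_add_int_mul]
    rw [hus] at hu
    have hc := hF.cone_α s τ hk.le hτδ
    rw [hu, sub_self, zero_sub, norm_neg, norm_mul, Complex.norm_real, Real.norm_eq_abs] at hc
    have : |s - τ| = 0 := by nlinarith [abs_nonneg (s - τ)]
    rw [abs_eq_zero, sub_eq_zero] at this
    rw [← this, hs]; ring
  · exfalso
    set s := u - P.θ (P.diagram.partner p) - k * (2 * π) with hs
    have hus : L.strand (P.comp (P.diagram.partner p)) u =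
        L.strand (P.comp (P.diagram.partner p)) (P.θ (P.diagram.partner p) + s) := by
      rw [show P.θ (P.diagram.partner p) + s = u + ((-k : ℤ) : ℝ) * (2 * π) by
        rw [hs]; push_cast; ring, L.strand_add_int_mul]
    rw [hus] at hu
    refine ne_add_of_cones (v := 0) hκ0.le (fun s hs => hF.cone_β₀ hs) hk.le (hF.cone_α₀ hτδ)
      h2κ ?_ (by rw [add_zero]; exact hu)
    rw [norm_zero, mul_zero, zero_mul]
    exact mul_pos (abs_pos.2 hτ0) (abs_pos.2 hD)

/-- **From the hugging point to the deep point.** For all small `τ > 0` and every height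
`0 < ε ≤ μ₁ τ`, the total winding number about the point `γₐ (tₐ + σ τ) + ε σ' U` hugging the
strand of `p` equals that about the deep point `y + τ (σ V + σ' U)` of the same quadrant.
[folklore] -/
theorem windSum_hug_eq_deep (P : L.RegularProjection) [Fintype ι] (p : Fin (2 * P.diagram.n))
    {σ σ' : ℝ} (hσ : σ = 1 ∨ σ = -1) (hσ' : σ' = 1 ∨ σ' = -1) :
    ∀ᶠ τ in 𝓝[>] (0 : ℝ), ∀ ε, 0 < ε → ε ≤ crossμ (P.vel p) (P.vel (P.diagram.partner p)) * τ →
      L.windSum (L.strand (P.comp p) (P.θ p + σ * τ) +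
        ((ε * σ' : ℝ) : ℂ) * P.vel (P.diagram.partner p)) =
      L.windSum (P.pt p + (τ : ℂ) * ((σ : ℂ) * P.vel p +
        (σ' : ℂ) * P.vel (P.diagram.partner p))) := by
  obtain ⟨δ, η, -, hF, -, -⟩ := P.exists_isCrossFrame p
  have hD := P.im_vel_mul_conj_ne_zero p
  obtain ⟨hN0, -⟩ := cross_consts hD
  set V := P.vel p with hV
  set U := P.vel (P.diagram.partner p) with hU
  set N := crossN V U with hN
  set τ₁ := min δ (η / (2 * N)) with hτ₁
  have hτ₁0 : 0 < τ₁ := lt_min hF.δ_pos (div_pos hF.η_pos (by positivity))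
  filter_upwards [Ioo_mem_nhdsGT hτ₁0] with τ hτ ε hε0 hεμ
  have hτδ : τ ≤ δ := (hτ.2.trans_le (min_le_left _ _)).le
  have hτη : 2 * τ * N ≤ η := by
    have := hτ.2.trans_le (min_le_right _ _)
    rw [lt_div_iff₀ (by positivity)] at this
    linarith
  set α : ℝ → ℂ := fun s => L.strand (P.comp p) (P.θ p + s) with hα
  -- segment 1: hugging the strand from height `ε` to height `μ₁ τ`
  have h1 : L.windSum (α (σ * τ) + ((ε * σ' : ℝ) : ℂ) * U) =
      L.windSum (α (σ * τ) + ((crossμ V U * τ * σ' : ℝ) : ℂ) * U) := by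
    refine P.windSum_eq_of_segment fun μ hμ => ?_
    have e : α (σ * τ) + ((ε * σ' : ℝ) : ℂ) * U +
        (μ : ℂ) * (α (σ * τ) + ((crossμ V U * τ * σ' : ℝ) : ℂ) * U -
          (α (σ * τ) + ((ε * σ' : ℝ) : ℂ) * U)) =
        α (σ * τ) + (((ε + μ * (crossμ V U * τ - ε)) * σ' : ℝ) : ℂ) * U := by
      push_cast; ring
    rw [e]
    exact hF.hug_notMem hD hσ hσ' hτ.1 hτδ hτη (by nlinarith [hμ.1, hμ.2])
      (by nlinarith [hμ.1, hμ.2])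
  -- segment 2: into the quadrant
  have h2 : L.windSum (α (σ * τ) + ((crossμ V U * τ * σ' : ℝ) : ℂ) * U) =
      L.windSum (P.pt p + (τ : ℂ) * ((σ : ℂ) * V + (σ' : ℂ) * U)) := by
    refine P.windSum_eq_of_segment fun lam hl => ?_
    have e : α (σ * τ) + ((crossμ V U * τ * σ' : ℝ) : ℂ) * U +
        (lam : ℂ) * (P.pt p + (τ : ℂ) * ((σ : ℂ) * V + (σ' : ℂ) * U) -
          (α (σ * τ) + ((crossμ V U * τ * σ' : ℝ) : ℂ) * U)) =
        ((1 - lam : ℝ) : ℂ) * (α (σ * τ) + ((crossμ V U * τ * σ' : ℝ) : ℂ) * U) +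
          (lam : ℂ) * (P.pt p + (τ : ℂ) * ((σ : ℂ) * V + (σ' : ℂ) * U)) := by
      push_cast; ring
    rw [e]
    exact hF.diag_notMem hD hσ hσ' hτ.1 hτδ hτη hl
  exact h1.trans h2

/-- **The left side of the strand of `p` near the crossing, from deep points.** For small
`τ > 0`, the left winding number of the strand of `p` at the parameter `θ p + σ τ` (just after
the crossing for `σ = 1`, just before for `σ = -1`) is the total winding number about the deep
point `y + τ (σ V + σ' U)`, `σ'` the side sign. [folklore] -/
theorem leftWind_eq_windSum_deep (P : L.RegularProjection) [Fintype ι]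
    (p : Fin (2 * P.diagram.n)) {σ : ℝ} (hσ : σ = 1 ∨ σ = -1) :
    ∀ᶠ τ in 𝓝[>] (0 : ℝ), L.leftWind (P.comp p) (P.θ p + σ * τ) =
      L.windSum (P.pt p + (τ : ℂ) * ((σ : ℂ) * P.vel p +
        (P.crossSign p : ℂ) * P.vel (P.diagram.partner p))) := by
  obtain ⟨δ, η, -, hF, hvel, -⟩ := P.exists_isCrossFrame p
  have hD := P.im_vel_mul_conj_ne_zero p
  obtain ⟨hN0, -, -, hμ0, -, hκ0, -, h4U, -⟩ := cross_consts hD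
  set V := P.vel p with hV
  set U := P.vel (P.diagram.partner p) with hU
  have hσ1 : |σ| = 1 := by rcases hσ with rfl | rfl <;> simp
  have hsimple : ∀ᶠ τ in 𝓝[>] (0 : ℝ), L.IsSimplePt (P.comp p) (P.θ p + σ * τ) := by
    have h := P.isSimplePt_near_crossing p
    have h' : ∀ᶠ τ in 𝓝 (0 : ℝ), σ * τ ≠ 0 → L.IsSimplePt (P.comp p) (P.θ p + σ * τ) := by
      have hc : Tendsto (fun τ : ℝ => σ * τ) (𝓝 0) (𝓝 0) := by
        have := (continuous_const_mul σ).tendsto (0 : ℝ); rwa [mul_zero] at this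
      exact hc.eventually h
    filter_upwards [nhdsWithin_le_nhds h', self_mem_nhdsWithin] with τ h1 h2
    exact h1 (mul_ne_zero (by rcases hσ with rfl | rfl <;> norm_num) (ne_of_gt h2))
  have hδev : ∀ᶠ τ in 𝓝[>] (0 : ℝ), τ ≤ δ :=
    mem_of_superset (Ioo_mem_nhdsGT hF.δ_pos) fun τ hτ => hτ.2.le
  filter_upwards [hsimple, hδev, P.windSum_hug_eq_deep p hσ (P.crossSign_eq_or p),
    self_mem_nhdsWithin] with τ hsτ hτδ hquad hτ0
  have hτ0' : (0 : ℝ) < τ := hτ0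
  -- `σ' U` points to the left of the velocity at the nearby parameter
  set Vτ := L.strandDeriv (P.comp p) (P.θ p + σ * τ) with hVτ
  have hvτ : ‖Vτ - V‖ ≤ crossκ V U :=
    hvel (σ * τ) (by rw [abs_mul, hσ1, one_mul, abs_of_pos hτ0']; exact hτδ)
  have hleft : 0 < ((P.crossSign p : ℂ) * U * starRingEnd ℂ Vτ).im := by
    have hpos := P.crossSign_mul_im_pos p
    rw [← hU, ← hV] at hpos
    have e : (P.crossSign p : ℂ) * U * starRingEnd ℂ Vτ =
        (P.crossSign p : ℂ) * (U * starRingEnd ℂ V) +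
          (P.crossSign p : ℂ) * (U * starRingEnd ℂ (Vτ - V)) := by
      rw [map_sub]; ring
    rw [e, Complex.add_im, Complex.im_ofReal_mul, Complex.im_ofReal_mul]
    have hb : |(U * starRingEnd ℂ (Vτ - V)).im| ≤ ‖U‖ * crossκ V U := by
      refine (Complex.abs_im_le_norm _).trans ?_
      rw [norm_mul, Complex.norm_conj]
      exact mul_le_mul_of_nonneg_left hvτ (norm_nonneg U)
    have hs1 : |P.crossSign p| = 1 := by rcases P.crossSign_eq_or p with h | h <;> simp [h]
    have hb' : |P.crossSign p * (U * starRingEnd ℂ (Vτ - V)).im| ≤ ‖U‖ * crossκ V U := by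
      rw [abs_mul, hs1, one_mul]; exact hb
    have hDa : |(U * starRingEnd ℂ V).im| = |(V * starRingEnd ℂ U).im| := abs_im_mul_conj_comm U V
    have hge : |(V * starRingEnd ℂ U).im| ≤ P.crossSign p * (U * starRingEnd ℂ V).im := by
      rw [← hDa]
      have : |P.crossSign p * (U * starRingEnd ℂ V).im| = |(U * starRingEnd ℂ V).im| := by
        rw [abs_mul, hs1, one_mul]
      rw [← this]; exact (abs_of_pos hpos).le
    have := neg_abs_le (P.crossSign p * (U * starRingEnd ℂ (Vτ - V)).im)
    nlinarith [norm_nonneg U]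
  have hside := P.windSum_add_eq_leftWind hsτ hleft
  have hIoc : ∀ᶠ ε in 𝓝[>] (0 : ℝ), ε ∈ Ioc 0 (crossμ V U * τ) :=
    Ioc_mem_nhdsGT (mul_pos hμ0 hτ0')
  obtain ⟨ε, hε1, hε2⟩ := (hside.and hIoc).exists
  rw [← hε1, ← hquad ε hε2.1 hε2.2]
  congr 2
  push_cast; ring

/-- **The right side of the strand of `p` near the crossing, from deep points**: the total
winding number about the deep point `y + τ (σ V - σ' U)` is the left winding number at
`θ p + σ τ` minus one. [folklore] -/
theorem leftWind_sub_one_eq_windSum_deep (P : L.RegularProjection) [Fintype ι]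
    (p : Fin (2 * P.diagram.n)) {σ : ℝ} (hσ : σ = 1 ∨ σ = -1) :
    ∀ᶠ τ in 𝓝[>] (0 : ℝ), L.leftWind (P.comp p) (P.θ p + σ * τ) - 1 =
      L.windSum (P.pt p + (τ : ℂ) * ((σ : ℂ) * P.vel p +
        ((-P.crossSign p : ℝ) : ℂ) * P.vel (P.diagram.partner p))) := by
  obtain ⟨δ, η, -, hF, hvel, -⟩ := P.exists_isCrossFrame p
  have hD := P.im_vel_mul_conj_ne_zero p
  obtain ⟨hN0, -, -, hμ0, -, hκ0, -, h4U, -⟩ := cross_consts hD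
  set V := P.vel p with hV
  set U := P.vel (P.diagram.partner p) with hU
  have hσ1 : |σ| = 1 := by rcases hσ with rfl | rfl <;> simp
  have hσ'' : -P.crossSign p = 1 ∨ -P.crossSign p = -1 := by
    rcases P.crossSign_eq_or p with h | h <;> simp [h]
  have hsimple : ∀ᶠ τ in 𝓝[>] (0 : ℝ), L.IsSimplePt (P.comp p) (P.θ p + σ * τ) := by
    have h := P.isSimplePt_near_crossing p
    have h' : ∀ᶠ τ in 𝓝 (0 : ℝ), σ * τ ≠ 0 → L.IsSimplePt (P.comp p) (P.θ p + σ * τ) := by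
      have hc : Tendsto (fun τ : ℝ => σ * τ) (𝓝 0) (𝓝 0) := by
        have := (continuous_const_mul σ).tendsto (0 : ℝ); rwa [mul_zero] at this
      exact hc.eventually h
    filter_upwards [nhdsWithin_le_nhds h', self_mem_nhdsWithin] with τ h1 h2
    exact h1 (mul_ne_zero (by rcases hσ with rfl | rfl <;> norm_num) (ne_of_gt h2))
  have hδev : ∀ᶠ τ in 𝓝[>] (0 : ℝ), τ ≤ δ :=
    mem_of_superset (Ioo_mem_nhdsGT hF.δ_pos) fun τ hτ => hτ.2.le
  filter_upwards [hsimple, hδev, P.windSum_hug_eq_deep p hσ hσ'', self_mem_nhdsWithin]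
    with τ hsτ hτδ hquad hτ0
  have hτ0' : (0 : ℝ) < τ := hτ0
  set Vτ := L.strandDeriv (P.comp p) (P.θ p + σ * τ) with hVτ
  have hvτ : ‖Vτ - V‖ ≤ crossκ V U :=
    hvel (σ * τ) (by rw [abs_mul, hσ1, one_mul, abs_of_pos hτ0']; exact hτδ)
  have hright : (((-P.crossSign p : ℝ) : ℂ) * U * starRingEnd ℂ Vτ).im < 0 := by
    have hpos := P.crossSign_mul_im_pos p
    rw [← hU, ← hV] at hpos
    have e : ((-P.crossSign p : ℝ) : ℂ) * U * starRingEnd ℂ Vτ =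
        -((P.crossSign p : ℂ) * (U * starRingEnd ℂ V) +
          (P.crossSign p : ℂ) * (U * starRingEnd ℂ (Vτ - V))) := by
      rw [map_sub]; push_cast; ring
    rw [e, Complex.neg_im, Complex.add_im, Complex.im_ofReal_mul, Complex.im_ofReal_mul,
      neg_lt_zero]
    have hb : |(U * starRingEnd ℂ (Vτ - V)).im| ≤ ‖U‖ * crossκ V U := by
      refine (Complex.abs_im_le_norm _).trans ?_
      rw [norm_mul, Complex.norm_conj]
      exact mul_le_mul_of_nonneg_left hvτ (norm_nonneg U)
    have hs1 : |P.crossSign p| = 1 := by rcases P.crossSign_eq_or p with h | h <;> simp [h]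
    have hb' : |P.crossSign p * (U * starRingEnd ℂ (Vτ - V)).im| ≤ ‖U‖ * crossκ V U := by
      rw [abs_mul, hs1, one_mul]; exact hb
    have hDa : |(U * starRingEnd ℂ V).im| = |(V * starRingEnd ℂ U).im| := abs_im_mul_conj_comm U V
    have hge : |(V * starRingEnd ℂ U).im| ≤ P.crossSign p * (U * starRingEnd ℂ V).im := by
      rw [← hDa]
      have : |P.crossSign p * (U * starRingEnd ℂ V).im| = |(U * starRingEnd ℂ V).im| := by
        rw [abs_mul, hs1, one_mul]
      rw [← this]; exact (abs_of_pos hpos).le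
    have := neg_abs_le (P.crossSign p * (U * starRingEnd ℂ (Vτ - V)).im)
    nlinarith [norm_nonneg U]
  have hside := P.windSum_add_eq_leftWind_sub_one hsτ hright
  have hIoc : ∀ᶠ ε in 𝓝[>] (0 : ℝ), ε ∈ Ioc 0 (crossμ V U * τ) :=
    Ioc_mem_nhdsGT (mul_pos hμ0 hτ0')
  obtain ⟨ε, hε1, hε2⟩ := (hside.and hIoc).exists
  rw [← hε1, ← hquad ε hε2.1 hε2.2]
  congr 2
  push_cast; ring

/-- **The crossing relations.** For all small `τ > 0`: (jump) the left winding numbers of the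
strand of `p` just after and just before the crossing have different parity; (partner) the left
winding numbers of the two strands just after the crossing have different parity. Proof: the
eight deep-point formulas for `p` and its partner identify the total winding numbers of the four
quadrants with `ℓ ± 1`-shifts of the four left winding numbers. [folklore] -/
theorem leftWind_crossing (P : L.RegularProjection) [Fintype ι] (p : Fin (2 * P.diagram.n)) :
    ∀ᶠ τ in 𝓝[>] (0 : ℝ),
      ((L.leftWind (P.comp p) (P.θ p + τ) : ℤ) : ZMod 2) =
          L.leftWind (P.comp p) (P.θ p - τ) + 1 ∧
        ((L.leftWind (P.comp (P.diagram.partner p)) (P.θ (P.diagram.partner p) + τ) : ℤ) :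
          ZMod 2) = L.leftWind (P.comp p) (P.θ p + τ) + 1 := by
  set q := P.diagram.partner p with hq
  have hqp : P.diagram.partner q = p := by rw [hq, LinkGaussDiagram.partner_partner]
  have h1 : (1 : ℝ) = 1 ∨ (1 : ℝ) = -1 := Or.inl rfl
  have hm1 : (-1 : ℝ) = 1 ∨ (-1 : ℝ) = -1 := Or.inr rfl
  filter_upwards [P.leftWind_eq_windSum_deep p h1, P.leftWind_eq_windSum_deep p hm1,
    P.leftWind_sub_one_eq_windSum_deep p h1, P.leftWind_sub_one_eq_windSum_deep p hm1,
    P.leftWind_eq_windSum_deep q h1, P.leftWind_sub_one_eq_windSum_deep q h1]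
    with τ p1 p2 p3 p4 q1 q3
  rw [hqp, P.pt_partner] at q1 q3
  simp only [one_mul, neg_one_mul, ← sub_eq_add_neg] at p1 p2 p3 p4 q1 q3
  have cast : ∀ {m n : ℤ}, m = n - 1 → ((m : ℤ) : ZMod 2) = n + 1 := by
    intro m n h; rw [h]; push_cast
    have h2 : (2 : ZMod 2) = 0 := by decide
    linear_combination -h2
  rcases P.crossSign_cases p with ⟨hp, hq'⟩ | ⟨hp, hq'⟩
  · rw [← hq] at hq'
    simp only [hp, hq'] at p1 p2 p3 p4 q1 q3
    push_cast at p1 p2 p3 p4 q1 q3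
    -- `ℓa⁺ = ℓb⁺ - 1`, `ℓa⁻ = ℓb⁺`
    have eX : L.leftWind (P.comp p) (P.θ p + τ) = L.leftWind (P.comp q) (P.θ q + τ) - 1 := by
      rw [q3, p1]; congr 2; ring
    have eJ : L.leftWind (P.comp p) (P.θ p - τ) = L.leftWind (P.comp q) (P.θ q + τ) := by
      rw [q1, p2]; congr 2; ring
    refine ⟨?_, ?_⟩
    · rw [eJ]; exact cast eX
    · rw [eX]; push_cast; ring
  · rw [← hq] at hq'
    simp only [hp, hq'] at p1 p2 p3 p4 q1 q3
    push_cast at p1 p2 p3 p4 q1 q3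
    -- `ℓb⁺ = ℓa⁺ - 1`, `ℓb⁺ - 1 = ℓa⁻ - 1`
    have eX : L.leftWind (P.comp q) (P.θ q + τ) = L.leftWind (P.comp p) (P.θ p + τ) - 1 := by
      rw [p3, q1]; congr 2; ring
    have eJ : L.leftWind (P.comp q) (P.θ q + τ) - 1 = L.leftWind (P.comp p) (P.θ p - τ) - 1 := by
      rw [q3, p4]; congr 2; ring
    refine ⟨?_, ?_⟩
    · have : L.leftWind (P.comp p) (P.θ p - τ) = L.leftWind (P.comp p) (P.θ p + τ) - 1 := by
        linarith
      rw [this]; push_cast; ring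
    · exact cast eX

end Link.RegularProjection

namespace Link.RegularProjection

variable {ι : Type*} {L : Link ι}

/-! ## 6. Combinatorics of the traversal: the arc following a marked point -/

/-- A parameter that is not (modulo `2π`) the parameter of a marked point of the component is a
simple point (`eq_or_crossing`). [folklore] -/
theorem isSimplePt_of_forall_ne (P : L.RegularProjection) {a : ι} {t : ℝ}
    (h : ∀ r, P.comp r = a → ∀ k : ℤ, t ≠ P.θ r + k * (2 * π)) : L.IsSimplePt a t := by
  intro c s hs
  rw [strand_eq_iff] at hs
  rcases P.eq_or_crossing c a s t hs with ⟨hc, k, hk⟩ | ⟨j, k, l, hset⟩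
  · exact ⟨hc, -k, by rw [hk]; push_cast; ring⟩
  · exfalso
    have hmem : (a, t + l * (2 * π)) ∈ ({(P.comp (P.diagram.overPos j),
        P.θ (P.diagram.overPos j)), (P.comp (P.diagram.underPos j), P.θ (P.diagram.underPos j))} :
        Set (ι × ℝ)) := hset ▸ mem_insert_of_mem _ rfl
    simp only [mem_insert_iff, mem_singleton_iff] at hmem
    have read : ∀ r, (a, t + l * (2 * π)) = (P.comp r, P.θ r) → False := fun r hr => by
      have h1 : a = P.comp r := congrArg Prod.fst hr
      have h2 : t + l * (2 * π) = P.θ r := congrArg Prod.snd hr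
      exact h r h1.symm (-l) (by rw [← h2]; push_cast; ring)
    rcases hmem with h1 | h1
    · exact read _ h1
    · exact read _ h1

/-- **Enumeration of a component from its base point.** The component of `p` is
`{b₀, next b₀, …, next^m' b₀}` with strictly increasing parameters, all within `θ b₀ + 2π`,
and `next^(m'+1) b₀ = b₀` (`b₀` the successor of the wrap point). [folklore] -/
theorem exists_base (P : L.RegularProjection) (p : Fin (2 * P.diagram.n)) :
    ∃ (b₀ : Fin (2 * P.diagram.n)) (m' : ℕ), P.comp b₀ = P.comp p ∧
      (P.diagram.next ^ (m' + 1)) b₀ = b₀ ∧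
      (∀ r, P.comp r = P.comp p → ∃ j ≤ m', (P.diagram.next ^ j) b₀ = r) ∧
      StrictMono (fun j : Fin (m' + 1) => P.θ ((P.diagram.next ^ (j : ℕ)) b₀)) ∧
      P.θ ((P.diagram.next ^ m') b₀) < P.θ b₀ + 2 * π := by
  classical
  set nx := P.diagram.next with hnx
  have hT := P.traversal
  obtain ⟨d, hd, hdθ⟩ := IsTraversalOrder.exists_wrap nx P.θ p
  set b₀ := nx d with hb₀
  have hcb : P.comp b₀ = P.comp p := by
    rw [hb₀, hT.comp_next]; exact (hT.comp_eq_of_sameCycle hd).symm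
  -- the minimal period of the base point
  have hper : b₀ ∈ Function.periodicPts nx := by
    refine Function.mk_mem_periodicPts (orderOf_pos nx) ?_
    show (⇑nx)^[orderOf nx] b₀ = b₀
    rw [Equiv.Perm.iterate_eq_pow, pow_orderOf_eq_one]; rfl
  have hm0 : 0 < Function.minimalPeriod nx b₀ := Function.minimalPeriod_pos_of_mem_periodicPts hper
  obtain ⟨m', hm'⟩ : ∃ m', Function.minimalPeriod nx b₀ = m' + 1 :=
    Nat.exists_eq_add_one_of_ne_zero hm0.ne'
  have hcyc : (nx ^ (m' + 1)) b₀ = b₀ := by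
    rw [← hm', ← Equiv.Perm.iterate_eq_pow]; exact Function.iterate_minimalPeriod
  have hnoret : ∀ j < m', (nx ^ (j + 1)) (nx d) ≠ nx d := by
    intro j hj h
    have : Function.IsPeriodicPt nx (j + 1) b₀ := by
      show (⇑nx)^[j + 1] b₀ = b₀; rw [Equiv.Perm.iterate_eq_pow]; exact h
    exact Function.not_isPeriodicPt_of_pos_of_lt_minimalPeriod (by omega) (by rw [hm']; omega)
      this
  refine ⟨b₀, m', hcb, hcyc, fun r hr => ?_, hT.strictMono_of_wrap hdθ hnoret, ?_⟩
  · have hsc : nx.SameCycle b₀ r := hT.sameCycle_of_comp_eq (hcb.trans hr.symm)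
    obtain ⟨i, hi⟩ := hsc.exists_nat_pow_eq
    refine ⟨i % (m' + 1), Nat.lt_succ_iff.1 (Nat.mod_lt _ (by omega)), ?_⟩
    rw [← hm', ← Equiv.Perm.iterate_eq_pow, Function.iterate_mod_minimalPeriod_eq,
      Equiv.Perm.iterate_eq_pow, hi]
  · have hc : P.comp ((nx ^ m') b₀) = P.comp b₀ := hT.comp_pow b₀ m'
    exact hT.lt_add_two_pi _ _ hc

/-- **The end of the arc following `p`**: the parameter of `next p`, lifted by `2π` at the wrap
point of the component. [folklore] -/
def arcEnd (P : L.RegularProjection) (p : Fin (2 * P.diagram.n)) : ℝ :=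
  if P.θ (P.diagram.next p) ≤ P.θ p then P.θ (P.diagram.next p) + 2 * π
  else P.θ (P.diagram.next p)

/-- The arc following `p` is non-degenerate. [folklore] -/
theorem θ_lt_arcEnd (P : L.RegularProjection) (p : Fin (2 * P.diagram.n)) : P.θ p < P.arcEnd p := by
  unfold arcEnd
  split_ifs with h
  · linarith [P.traversal.lt_add_two_pi p (P.diagram.next p) (P.traversal.comp_next p).symm]
  · exact not_le.1 h

/-- The end of the arc is the parameter of `next p` up to a period. [folklore] -/
theorem exists_arcEnd_eq (P : L.RegularProjection) (p : Fin (2 * P.diagram.n)) :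
    ∃ k : ℤ, P.arcEnd p = P.θ (P.diagram.next p) + k * (2 * π) := by
  unfold arcEnd
  split_ifs
  · exact ⟨1, by push_cast; ring⟩
  · exact ⟨0, by push_cast; ring⟩

/-- **No marked point of the component inside the arc** `(θ p, arcEnd p)`, even up to periods:
read off the enumeration from the base point. [folklore] -/
theorem not_mem_arc (P : L.RegularProjection) {p r : Fin (2 * P.diagram.n)}
    (hr : P.comp r = P.comp p) (k : ℤ) : P.θ r + k * (2 * π) ∉ Ioo (P.θ p) (P.arcEnd p) := by
  obtain ⟨b₀, m', -, hcyc, hall, hmono, hwin⟩ := P.exists_base p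
  obtain ⟨i, hi, rfl⟩ := hall p rfl
  obtain ⟨j, hj, rfl⟩ := hall r hr
  set nx := P.diagram.next with hnx
  have hπ : (0 : ℝ) < 2 * π := by positivity
  -- bounds from the enumeration
  have bound : ∀ {x : ℕ}, x ≤ m' →
      P.θ b₀ ≤ P.θ ((nx ^ x) b₀) ∧ P.θ ((nx ^ x) b₀) ≤ P.θ ((nx ^ m') b₀) := by
    intro x hx
    constructor
    · have := hmono.monotone (show (⟨0, by omega⟩ : Fin (m' + 1)) ≤ ⟨x, by omega⟩ from
        Fin.mk_le_mk.2 (Nat.zero_le x))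
      simpa using this
    · exact hmono.monotone (show (⟨x, by omega⟩ : Fin (m' + 1)) ≤ ⟨m', by omega⟩ from
        Fin.mk_le_mk.2 hx)
  have hlt : ∀ {x y : ℕ} (hx : x ≤ m') (hy : y ≤ m'),
      P.θ ((nx ^ x) b₀) < P.θ ((nx ^ y) b₀) → x < y := by
    intro x y hx hy h
    have := hmono.lt_iff_lt.1 (show (fun j : Fin (m' + 1) => P.θ ((nx ^ (j : ℕ)) b₀))
      ⟨x, by omega⟩ < (fun j : Fin (m' + 1) => P.θ ((nx ^ (j : ℕ)) b₀)) ⟨y, by omega⟩ from h)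
    exact this
  obtain ⟨hb₀i, him'⟩ := bound hi
  obtain ⟨hb₀j, hjm'⟩ := bound hj
  rintro ⟨h1, h2⟩
  have hk : k = 0 ∨ 1 ≤ k ∨ k ≤ -1 := by omega
  rcases lt_or_eq_of_le hi with hi' | rfl
  · -- not the wrap point: `arcEnd p = θ (next p)`, `next p = nx ^ (i + 1) b₀`
    have hnext : nx ((nx ^ i) b₀) = (nx ^ (i + 1)) b₀ := by rw [pow_succ', Equiv.Perm.mul_apply]
    have hθlt : P.θ ((nx ^ i) b₀) < P.θ ((nx ^ (i + 1)) b₀) :=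
      hmono (show (⟨i, by omega⟩ : Fin (m' + 1)) < ⟨i + 1, by omega⟩ from Fin.mk_lt_mk.2 (by omega))
    have harc : P.arcEnd ((nx ^ i) b₀) = P.θ ((nx ^ (i + 1)) b₀) := by
      unfold arcEnd; rw [hnext, if_neg (not_le.2 hθlt)]
    rw [harc] at h2
    obtain ⟨-, hi1m'⟩ := bound (show i + 1 ≤ m' by omega)
    rcases hk with rfl | hk1 | hk1
    · simp only [Int.cast_zero, zero_mul, add_zero] at h1 h2
      have := hlt hi hj h1
      have := hlt hj (by omega) h2
      omega
    · have : (1 : ℝ) ≤ k := by exact_mod_cast hk1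
      nlinarith
    · have : (k : ℝ) ≤ -1 := by exact_mod_cast hk1
      nlinarith
  · -- the wrap point: `next p = b₀`, `arcEnd p = θ b₀ + 2π`
    have hnext : nx ((nx ^ i) b₀) = b₀ := by
      rw [← Equiv.Perm.mul_apply, ← pow_succ']; exact hcyc
    have harc : P.arcEnd ((nx ^ i) b₀) = P.θ b₀ + 2 * π := by
      unfold arcEnd; rw [hnext, if_pos hb₀i]
    rw [harc] at h2
    rcases hk with rfl | hk1 | hk1
    · simp only [Int.cast_zero, zero_mul, add_zero] at h1; linarith
    · have : (1 : ℝ) ≤ k := by exact_mod_cast hk1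
      nlinarith
    · have : (k : ℝ) ≤ -1 := by exact_mod_cast hk1
      nlinarith

/-- **The arc following a marked point consists of simple points.** [folklore] -/
theorem isSimplePt_of_mem_arc (P : L.RegularProjection) (p : Fin (2 * P.diagram.n)) {t : ℝ}
    (ht : t ∈ Ioo (P.θ p) (P.arcEnd p)) : L.IsSimplePt (P.comp p) t :=
  P.isSimplePt_of_forall_ne fun _ hr k h => P.not_mem_arc hr k (h ▸ ht)

/-! ## 7. The colouring and the main theorem -/

/-- The midpoint of the arc following `p`. [folklore] -/
def mid (P : L.RegularProjection) (p : Fin (2 * P.diagram.n)) : ℝ := (P.θ p + P.arcEnd p) / 2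

/-- The midpoint lies inside the arc. [folklore] -/
theorem mid_mem (P : L.RegularProjection) (p : Fin (2 * P.diagram.n)) :
    P.mid p ∈ Ioo (P.θ p) (P.arcEnd p) := by
  have := P.θ_lt_arcEnd p
  unfold mid
  constructor <;> linarith

/-- **The checkerboard colouring of a regular projection**: the parity of the total winding
number of the projection about the region to the left of the arc leaving the marked point `p`
(the left winding number at the midpoint of that arc). [folklore] -/
def colour (P : L.RegularProjection) [Fintype ι] (p : Fin (2 * P.diagram.n)) : Bool :=
  decide (((L.leftWind (P.comp p) (P.mid p) : ℤ) : ZMod 2) = 1)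

/-- The left winding number just after a marked point is that at the midpoint of its arc.
[folklore] -/
theorem leftWind_eq_mid_right (P : L.RegularProjection) [Fintype ι] (p : Fin (2 * P.diagram.n)) :
    ∀ᶠ τ in 𝓝[>] (0 : ℝ), L.leftWind (P.comp p) (P.θ p + τ) = L.leftWind (P.comp p) (P.mid p) := by
  obtain ⟨h1, h2⟩ := P.mid_mem p
  filter_upwards [Ioo_mem_nhdsGT (sub_pos.2 h1)] with τ hτ
  exact P.leftWind_eq_of_isSimplePt (by linarith [hτ.2]) fun t ht =>
    P.isSimplePt_of_mem_arc p ⟨by linarith [ht.1, hτ.1], by linarith [ht.2]⟩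

/-- The left winding number just before `next p` is that at the midpoint of the arc of `p`
(constancy along the arc and periodicity at the wrap point). [folklore] -/
theorem leftWind_eq_mid_left (P : L.RegularProjection) [Fintype ι] (p : Fin (2 * P.diagram.n)) :
    ∀ᶠ τ in 𝓝[>] (0 : ℝ), L.leftWind (P.comp p) (P.θ (P.diagram.next p) - τ) =
      L.leftWind (P.comp p) (P.mid p) := by
  obtain ⟨h1, h2⟩ := P.mid_mem p
  obtain ⟨k, hk⟩ := P.exists_arcEnd_eq p
  filter_upwards [Ioo_mem_nhdsGT (sub_pos.2 h2)] with τ hτ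
  have e : P.θ (P.diagram.next p) - τ = (P.arcEnd p - τ) + (-k : ℤ) * (2 * π) := by
    rw [hk]; push_cast; ring
  rw [e, L.leftWind_add_int_mul]
  exact (P.leftWind_eq_of_isSimplePt (by linarith [hτ.2]) fun t ht =>
    P.isSimplePt_of_mem_arc p ⟨by linarith [ht.1], by linarith [ht.2, hτ.1]⟩).symm

/-- Reading a parity relation on Booleans. [folklore] -/
theorem decide_eq_not_decide {x y : ZMod 2} (h : y = x + 1) :
    decide (y = 1) = !decide (x = 1) := by
  subst h
  fin_cases x <;> decide

/-- **The colour changes at every marked point along the traversal.** [folklore] -/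
theorem colour_next (P : L.RegularProjection) [Fintype ι] (p : Fin (2 * P.diagram.n)) :
    P.colour (P.diagram.next p) = !P.colour p := by
  set q := P.diagram.next p with hq
  have hcq : P.comp q = P.comp p := P.traversal.comp_next p
  obtain ⟨τ, hjump, hl, hr⟩ := (((P.leftWind_crossing q).mono fun τ h => h.1).and
    ((P.leftWind_eq_mid_left p).and (P.leftWind_eq_mid_right q))).exists
  rw [hcq] at hjump hr
  unfold colour
  rw [hcq]
  refine decide_eq_not_decide ?_
  rw [← hr, hjump, hl]

/-- **The two ends of a chord have opposite colours.** [folklore] -/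
theorem colour_underPos (P : L.RegularProjection) [Fintype ι] (i : Fin P.diagram.n) :
    P.colour (P.diagram.underPos i) = !P.colour (P.diagram.overPos i) := by
  set o := P.diagram.overPos i with ho
  have hu : P.diagram.underPos i = P.diagram.partner o := by
    rw [ho, LinkGaussDiagram.partner_overPos]
  obtain ⟨τ, hX, ho', hu'⟩ := (((P.leftWind_crossing o).mono fun τ h => h.2).and
    ((P.leftWind_eq_mid_right o).and (P.leftWind_eq_mid_right (P.diagram.partner o)))).exists
  unfold colour
  rw [hu]
  refine decide_eq_not_decide ?_
  rw [← hu', hX, ho']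

/-- **The colouring read off a regular projection is a checkerboard colouring.**
[cite: Kauffman1999, §3.2 Lemma 1] -/
theorem isCheckerboard_colour (P : L.RegularProjection) [Fintype ι] :
    P.diagram.IsCheckerboard P.colour :=
  ⟨P.colour_next, P.colour_underPos⟩

/-- **Every link Gauss diagram read off a regular projection of a link admits a checkerboard
colouring** (Kauffman (1999), §3.2: planar Gauss codes are evenly intersticed; Rasmussen
(2010), Lemma 2.4: adjacent Seifert circles carry different labels). The colour of a marked
point is the parity of the total winding number of the projected link about the region to the
left of the arc leaving it; it changes at every marked point (the arc crosses a strand there,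
`leftWind_crossing`) and is opposite at the two ends of a chord (the two left-hand regions just
after a crossing are adjacent quadrants). [cite: Kauffman1999, §3.2 Lemma 1] -/
theorem exists_isCheckerboard (P : L.RegularProjection) : ∃ c, P.diagram.IsCheckerboard c := by
  haveI : Fintype ι := @Fintype.ofFinite ι P.finite_index
  exact ⟨P.colour, P.isCheckerboard_colour⟩

/-- Hence every component of a regular projection carries an even number of chord ends
(`IsCheckerboard.even_minimalPeriod`). [folklore] -/
theorem even_minimalPeriod_next (P : L.RegularProjection) (p : Fin (2 * P.diagram.n)) :
    Even (Function.minimalPeriod P.diagram.next p) := by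
  obtain ⟨c, hc⟩ := P.exists_isCheckerboard
  exact hc.even_minimalPeriod p

end Link.RegularProjection

/-! ### Corollaries for realisable link diagrams -/

/-- **A realisable link Gauss diagram is checkerboard colourable.**
[cite: Kauffman1999, §3.2 Lemma 1] -/
theorem Link.HasGaussDiagram.exists_isCheckerboard {ι : Type*} {L : Link ι}
    {D : LinkGaussDiagram} (h : L.HasGaussDiagram D) : ∃ c, D.IsCheckerboard c := by
  obtain ⟨P, rfl⟩ := h
  exact P.exists_isCheckerboard

/-- **The merge-or-split dichotomy for realisable link diagrams**: switching a `0`-smoothed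
crossing of any state of a link Gauss diagram read off a regular projection merges two circles
or splits one (`LinkGaussDiagram.dichotomy_of_isCheckerboard`). [cite: Rasmussen2010, §2.3] -/
theorem Link.HasGaussDiagram.isMergeAt_or_isSplitAt {ι : Type*} {L : Link ι}
    {D : LinkGaussDiagram} (h : L.HasGaussDiagram D) (σ : D.State) (i : Fin D.n)
    (hi : σ i = false) : D.IsMergeAt σ i ∨ D.IsSplitAt σ i := by
  obtain ⟨c, hc⟩ := h.exists_isCheckerboard
  exact LinkGaussDiagram.dichotomy_of_isCheckerboard hc σ i hi

/-- **`d² = 0` on the Khovanov complex of a realisable link diagram**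
(`LinkGaussDiagram.khovanovD_comp_khovanovD_of_isMergeAt_or_isSplitAt`). Bar-Natan (2002),
§3.2; Rasmussen (2010), §2. [cite: Rasmussen2010, §2.3] -/
theorem Link.HasGaussDiagram.khovanovD_comp_khovanovD {ι : Type*} {L : Link ι}
    {D : LinkGaussDiagram} (h : L.HasGaussDiagram D) (R : Type) [CommRing R] (hh t : R)
    (i : ℤ) : D.khovanovD R hh t (i + 1) (i + 1 + 1) ∘ₗ D.khovanovD R hh t i (i + 1) = 0 :=
  LinkGaussDiagram.khovanovD_comp_khovanovD_of_isMergeAt_or_isSplitAt D R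
    h.isMergeAt_or_isSplitAt hh t i

end Literature.Topology.FourManifolds
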